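import Mathlib
import Literature.Computability.Complexity.ExtMonotoneGates
import Literature.Computability.Complexity.CircuitPlug

/-!
# Route ConvexRankGates — crux `LinAlgGateBlind` (stmt-PneNP-10681), support:
# gate-by-gate basis substitution in straight-line programs

Line `invariant-module-linearisation` of the crux chain eliminates the PERM gates of a
`{∧₂,∨₂} ∪ PERM_s ∪ GRANK_s` circuit by replacing each of them with a small circuit over span
gates (its registered stub `stub_permElimination`: "`∃ C'` over `{∧₂,∨₂} ∪ SPAN_S ∪ GRANK_S` with
`C'.size ≤ 1 + M · C.size` and the same values"). The circuit-theoretic content of that step is the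
folklore closure of circuit size under GATE SUBSTITUTION (Vollmer 1999, §1.2): if every gate of `C`
whose gate function lies in a class `P` has a program over `B'` with at most `M ≥ 1` gates computing
its truth table, and the other gate functions of `C` lie in `B'`, then some circuit over `B'` with
at most `M · C.size` gates computes the same function. The tree's composition calculus
(`CircuitComposition`, `CircuitPlug`: `reloc`, `vals_append_reloc`, `wireOf_shiftWire`) is stated for
appending whole circuits; this file proves the gate-by-gate substitution theorem from it,
definition-free:

* `exists_substBasis_gateList` — program level: translate a well-formed gate list `gs` over `B`
  into `gs'` over `B'` (`|gs'| ≤ M |gs|`) together with a wire map `φ` such that the wire `φ m` of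
  `gs'` carries the value of gate `m` of `gs` (induction along the program; a `P`-gate is replaced
  by its sub-program relocated behind the current translation with inputs fed from the translated
  argument wires, any other gate is copied with translated arguments).
* `exists_substBasis` — circuit level: `∃ C'` over `B'`, `C'.size ≤ M · C.size`, `C'.eval = C.eval`.
* `exists_substBasis_cruxBasis` — the registered form for the crux basis: replacing the PERM gates
  of a `{∧₂,∨₂} ∪ PERM_s ∪ GRANK_s` circuit by programs over a basis `B' ⊇ {∧₂,∨₂} ∪ GRANK_s`.

[folklore; H. Vollmer, *Introduction to Circuit Complexity* (1999), §1.2]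
-/

namespace Summit.PneNP.PneNP.Theorems

open Literature.Computability.Complexity Literature.Computability.Complexity.GateList

/-- **Gate-by-gate basis substitution, program level.** Let `M ≥ 1`, let every gate function of
`B` outside the class `P` lie in `B'`, and let `gs` be a well-formed program over `B` each of whose
`P`-gates `g` has a program over `B'` with `≤ M` gates computing its truth table `g.op`. Then there
are a well-formed program `gs'` over `B'` with `|gs'| ≤ M · |gs|` and a wire map `φ` such that, for
every gate position `m` of `gs`, the wire `φ m` exists in `gs'` and carries the value of gate `m`.
[folklore] -/
theorem exists_substBasis_gateList {ι : Type*} {B B' : Set GateFn} (P : GateFn → Prop) {M : ℕ}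
    (hM : 1 ≤ M) (hkeep : ∀ f ∈ B, ¬ P f → f ∈ B') :
    ∀ gs : List (Gate ι), WF gs → (∀ g ∈ gs, g.fn ∈ B) →
      (∀ g ∈ gs, P g.fn → CktSize B' (fun (v : Fin g.arity → Bool) (_ : Unit) => g.op v) M) →
      ∃ (gs' : List (Gate ι)) (φ : ℕ → ι ⊕ ℕ), WF gs' ∧ (∀ g ∈ gs', g.fn ∈ B') ∧
        gs'.length ≤ M * gs.length ∧
        ∀ m, m < gs.length → OutOK gs'.length (φ m) ∧
          ∀ x, wireOf x (vals gs' x) (φ m) = (vals gs x).getD m false := by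
  intro gs
  induction gs using List.reverseRecOn with
  | nil =>
    intro _ _ _
    exact ⟨[], fun _ => Sum.inr 0, WF.nil, fun g hg => by simp at hg, by simp, fun m hm => by simp at hm⟩
  | append_singleton gs g ih =>
    intro hwf hB hsub
    obtain ⟨gs', φ, hwf', hB', hlen, hφ⟩ := ih hwf.of_append_left
      (fun g' hg' => hB g' (List.mem_append_left _ hg'))
      (fun g' hg' => hsub g' (List.mem_append_left _ hg'))
    have hgmem : g ∈ gs ++ [g] := List.mem_append_right _ (List.mem_singleton_self g)
    -- the argument wires of `g` point below `gs.length`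
    have hg_ok : ∀ a m, g.args a = Sum.inr m → m < gs.length :=
      hwf gs.length g (by simp)
    -- translate them
    let ρ : Fin g.arity → ι ⊕ ℕ := fun a => match g.args a with
      | Sum.inl i => Sum.inl i
      | Sum.inr m => φ m
    have hρOK : WiresOK gs'.length ρ := by
      intro a m hm
      simp only [ρ] at hm
      cases ha : g.args a with
      | inl i => rw [ha] at hm; cases hm
      | inr m' => rw [ha] at hm; exact (hφ m' (hg_ok a m' ha)).1 m hm
    have hρval : ∀ x a, wireOf x (vals gs' x) (ρ a) = wireOf x (vals gs x) (g.args a) := by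
      intro x a
      simp only [ρ]
      cases ha : g.args a with
      | inl i => rfl
      | inr m' => exact (hφ m' (hg_ok a m' ha)).2 x
    -- values of `gs ++ [g]`: old positions unchanged, the new one is `g` applied to its arguments
    have hold : ∀ x m, m < gs.length →
        (vals (gs ++ [g]) x).getD m false = (vals gs x).getD m false := by
      intro x m hm
      have := wireOf_vals_append gs [g] x (Sum.inr m) (fun m' hm' => by cases hm'; exact hm)
      simpa using this
    have hnew : ∀ x, (vals (gs ++ [g]) x).getD gs.length false =
        g.op (fun a => wireOf x (vals gs x) (g.args a)) := fun x =>
      getD_vals_append_cons gs g [] x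
    by_cases hP : P g.fn
    · -- substitute the sub-program of `g`
      obtain ⟨A, out, hAlen, hA⟩ := hsub g hgmem hP
      refine ⟨gs' ++ A.map (reloc ρ gs'.length),
        Function.update φ gs.length (shiftWire ρ gs'.length (out ())),
        hwf'.append_reloc hA.wf hρOK, ?_, ?_, ?_⟩
      · intro g' hg'
        rw [List.mem_append, List.mem_map] at hg'
        rcases hg' with hg' | ⟨g'', hg'', rfl⟩
        · exact hB' g' hg'
        · rw [reloc_fn]
          exact hA.isOver g'' hg''
      · simp only [List.length_append, List.length_map, List.length_singleton]
        nlinarith [hlen, hAlen]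
      · intro m hm
        simp only [List.length_append, List.length_singleton] at hm
        rcases Nat.lt_succ_iff_lt_or_eq.1 hm with hm | rfl
        · rw [Function.update_of_ne (Nat.ne_of_lt hm)]
          refine ⟨fun m' hm' => ((hφ m hm).1 m' hm').trans_le (by simp), fun x => ?_⟩
          rw [wireOf_append_left x gs' _ (hφ m hm).1, (hφ m hm).2 x, hold x m hm]
        · rw [Function.update_self]
          refine ⟨?_, fun x => ?_⟩
          · intro m' hm'
            cases hout : out () with
            | inl a =>
              rw [hout] at hm'
              exact (hρOK a m' hm').trans_le (by simp)
            | inr m'' =>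
              rw [hout] at hm'
              simp only [shiftWire, Sum.inr.injEq] at hm'
              subst hm'
              have := hA.outOK () m'' hout
              simp only [List.length_append, List.length_map]
              omega
          · rw [vals_append_reloc gs' A ρ hρOK x,
              wireOf_shiftWire x (vals gs' x) _ (length_vals gs' x) ρ hρOK (out ()), hA.eval, hnew x]
            exact congrArg g.op (funext fun a => hρval x a)
    · -- keep the gate, with translated arguments
      let g' : Gate ι := ⟨g.arity, g.op, ρ⟩
      refine ⟨gs' ++ [g'], Function.update φ gs.length (Sum.inr gs'.length),
        wf_snoc hwf' (fun a m hm => hρOK a m hm), fn_mem_snoc hB' (hkeep _ (hB g hgmem) hP), ?_, ?_⟩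
      · simp only [List.length_append, List.length_singleton]
        nlinarith [hlen]
      · intro m hm
        simp only [List.length_append, List.length_singleton] at hm
        rcases Nat.lt_succ_iff_lt_or_eq.1 hm with hm | rfl
        · rw [Function.update_of_ne (Nat.ne_of_lt hm)]
          refine ⟨fun m' hm' => ((hφ m hm).1 m' hm').trans_le (by simp), fun x => ?_⟩
          rw [wireOf_append_left x gs' _ (hφ m hm).1, (hφ m hm).2 x, hold x m hm]
        · rw [Function.update_self]
          refine ⟨fun m' hm' => ?_, fun x => ?_⟩
          · simp only [Sum.inr.injEq] at hm'
            subst hm'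
            simp
          · rw [wireOf_inr, hnew x, getD_vals_append_cons gs' g' [] x]
            exact congrArg g.op (funext fun a => hρval x a)

/-- **Gate-by-gate basis substitution** (closure of circuit size under gate substitution,
Vollmer 1999 §1.2). Let `M ≥ 1`; let every gate function of `B` outside the class `P` lie in `B'`;
let `C` be a circuit over `B` each of whose `P`-gates `g` has a program over `B'` with `≤ M` gates
computing its truth table. Then some circuit over `B'` with at most `M · C.size` gates computes the
same function as `C`. [folklore] -/
theorem exists_substBasis {ι : Type*} {B B' : Set GateFn} (P : GateFn → Prop) {M : ℕ} (hM : 1 ≤ M)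
    (hkeep : ∀ f ∈ B, ¬ P f → f ∈ B') (C : Circuit ι) (hC : C.IsOver B)
    (hsub : ∀ g ∈ C.gates, P g.fn → CktSize B' (fun (v : Fin g.arity → Bool) (_ : Unit) => g.op v) M) :
    ∃ C' : Circuit ι, C'.IsOver B' ∧ C'.size ≤ M * C.size ∧ ∀ x, C'.eval x = C.eval x := by
  obtain ⟨gs', φ, hwf', hB', hlen, hφ⟩ :=
    exists_substBasis_gateList P hM hkeep C.gates (wf_gates C) hC hsub
  cases hout : C.output with
  | inl i =>
    refine ⟨toCircuit gs' (Sum.inl i) hwf' (fun m hm => by cases hm), hB', hlen, fun x => ?_⟩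
    rw [circuit_eval, circuit_eval, hout]
    rfl
  | inr m =>
    have hm : m < C.gates.length := C.wf_output m hout
    refine ⟨toCircuit gs' (φ m) hwf' (hφ m hm).1, hB', hlen, fun x => ?_⟩
    rw [circuit_eval, circuit_eval, hout]
    exact (hφ m hm).2 x

/-- **PERM-gate elimination in the crux basis by substitution** (registered form; the circuit
content of `stub_permElimination` of line `invariant-module-linearisation`): if every PERM gate of a
circuit `C` over `{∧₂,∨₂} ∪ PERM_s ∪ GRANK_s` has a program over a basis `B' ⊇ {∧₂,∨₂} ∪ GRANK_s` with
at most `M ≥ 1` gates computing its truth table, then some circuit over `B'` with at most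
`M · C.size` gates computes the same function. [folklore] -/
theorem exists_substBasis_cruxBasis : ∀ {ι : Type} (s M : ℕ) (B' : Set GateFn) (C : Circuit ι),
    C.IsOver ({GateFn.and 2, GateFn.or 2} ∪ {g | IsPermGate s g ∨ IsGRankGate s g}) → 1 ≤ M →
    {GateFn.and 2, GateFn.or 2} ∪ {g | IsGRankGate s g} ⊆ B' →
    (∀ g ∈ C.gates, IsPermGate s g.fn →
      CktSize B' (fun (v : Fin g.arity → Bool) (_ : Unit) => g.op v) M) →
    ∃ C' : Circuit ι, C'.IsOver B' ∧ C'.size ≤ M * C.size ∧ ∀ x, C'.eval x = C.eval x := by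
  intro ι s M B' C hC hM hB' hsub
  refine exists_substBasis (IsPermGate s) hM (fun f hf hP => hB' ?_) C hC hsub
  rcases hf with hf | hf | hf
  · exact Or.inl hf
  · exact absurd hf hP
  · exact Or.inr hf

end Summit.PneNP.PneNP.Theorems
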